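import Summits.CriticalPhenomena.PercolationContinuityZ3.Theorems.Transplant.KNCellsStepsDefsO
import Summits.CriticalPhenomena.PercolationContinuityZ3.Theorems.Transplant.KNCellsStepsDefs
import Summits.CriticalPhenomena.PercolationContinuityZ3.Theorems.Transplant.KNCellsSchemeO
import Summits.CriticalPhenomena.PercolationContinuityZ3.Theorems.Transplant.KNCellsProcessO
import Summits.CriticalPhenomena.PercolationContinuityZ3.Theorems.Transplant.KNCellsStepsChain
import Literature.Probability.Percolation.OrientedHistorySiteRenormalizationRun
import HarnessLib

/-!
# N2 (frames-only node `SamePDropOfSkeletonFrm₁`, OPEN) — ORIENTED MACRO LAYER (WAVE 0 (c1), (R-18) `q ≡ true`): the oriented twin of N1's `KNCellsStepsChain`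

builds on p205010 (kernel theorem, internal audit signed; external expert review pending) — nothing in this file uses p205010; NOTHING is claimed about the
open node `SamePDropOfSkeletonFrm₁` (`SamePDropOfSkeletonNeg₁` is CLOSED in the tree and untouched by this file).
Status sentence (coordinator 2026-08-20T04:30Z): "θ(p_c) = 0 on ℤ^d, all d ≥ 2 — kernel-verified (Lean 4/Mathlib, standard axioms); internal adversarial
audit SIGNED 2026-08-20 04:29Z; external expert review pending."
Lane `prim-bschramm-*`, seat `prim-bschramm-stmt` (gen 19); helper file (`--supports stmt-CriticalPhenomena-4575 --as helper`); N2-SCOPE §20, (R-18)/(R-19).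
PORT RULES (HOME/prim-bschramm-stmt-g19/lean/port_orient.py): the history-site API is replaced by its ORIENTED twin at the fixed quadrant `qNE := fun _ => true`
(`HState.choice ↦ HState.ochoice qNE`, `mstOf ↦ omstOf qNE`, `mst/stN ↦ omst/ostN qNE`, `occFinal ↦ ooccFinal qNE`, `Lawful ↦ OLawful qNE`, onward directions
`onward ↦ onwardO` = the POSITIVE ones, (N2-e)); every declaration whose text changes thereby — directly or through a changed declaration — is re-declared with the
suffix `O` (same namespace); unchanged declarations of the N1 file are NOT repeated (the N1 module is imported). Docstrings/citations are N1's.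
N1 HEADER (kept for the reader):
* `real_Aface_inter_le` — one step of (36): `μ(A'_j ∩ B_j ∩ G ∩ [ξ] ∩ L_j) ≤ (1-δ₂) μ(B_j ∩ G ∩ [ξ] ∩ L_j)` for `G` determined by the pairs
  of level `j` (pin `μ` on them: the pinned weighting is the weighting of (30), `pinW_Wfull_eq_Wt`);
* `real_Gch_inter_le` — the chain: `μ(G_j ∩ [ξ] ∩ D) ≤ (1-δ₂)^j μ(D)`;
* the geometric inputs of (37) as hypotheses — (I3) FACE PREFIX in its two consequences `Reach ⊆ A'_{K-1}` and `A'_j ⊆ A'_{j-1}` on lattice-only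
  configurations — give `mem_Aface_of_reach`; (I2) the TARGET LEMMA AT A FACE (`hface`: reaching `F^{j+1}` with probability `> 1 - δ₂` under the
  weighting of (30) makes level `j` good) gives `badA_subset_Bev`;
* **`real_badA_inter_le`** — (36)–(37) at the anchor `a'`: `μ(badA ∩ D) ≤ (1-δ₂)^K μ(D) + μ(Reachᶜ ∩ D)`.
[cite: KozmaNitzan2024, §4 p. 31 ((36), (37)) — the ℤ^d model] [cite: GrimmettPercolation1999, §7.2]
-/
noncomputable section

open MeasureTheory ProbabilityTheory
open scoped ENNReal Classical

namespace Summit.CriticalPhenomena.PercolationContinuityZ3.Theorems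

namespace Transplant

namespace KNCells

open Literature.Probability.Percolation Literature.Probability.LatticeModels SimpleGraph GadgetSystem ProbeHistory HSiteScheme Contour

variable {V : Type*} [DecidableEq V] [Countable V]

namespace KSchA

variable {A : Type*} {G : SimpleGraph V} [G.LocallyFinite] {S : KSchA V A} {FD : FaceData V A}
variable {h : ProbeHistory V} {e : Site 2 × MDir} (hV : S.ValidO G h e) {a a' : A} (ha' : a' ∈ S.Γ.anchSet a (tgt e)) {du : MDir}
  (hdu : du ∈ S.onwardO G h (tgt e)) (hSt : StepsGeom S.Γ FD)
include hV ha' hdu hSt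

/-! ## The chain (36) -/

/-- **One step of the chain**: `μ(A'_j ∩ B_j ∩ G ∩ [ξ] ∩ L_j) ≤ (1 - δ₂) μ(B_j ∩ G ∩ [ξ] ∩ L_j)` for `G` determined by the pairs of level `j` ("if
`B_j` happened then there is probability at least `δ₂` to not reach `F^{j+1}`, and this bound holds uniformly over … any `j' < j`", p. 31).
[cite: KozmaNitzan2024, §4 p. 31 ((36))] -/
theorem real_Aface_inter_leO {δ₂ : ℝ} {j : ℕ} (hj : j < S.Γ.K) {Gs : Set (BondConfig V)}
    (hG : DeterminedBy Gs (↑(S.Fp G h e a a' du j) : Set (Sym2 V))) :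
    (prodBernoulli (S.Wfull G h e a a' du)).real (S.Aface G FD h e a a' du j ∩ (S.BevO G FD h e a a' du j δ₂ ∩ Gs ∩
        localCylinder (↑(S.F G h) : Set (Sym2 V)) ↑(S.ξ G h) ∩
        KNLevels.lattOnly G (S.Vx G h ∪ S.Γ.Ewv a e.1 e.2 ∪ S.Γ.Stub a' (tgt e) du j))) ≤
      (1 - δ₂) * (prodBernoulli (S.Wfull G h e a a' du)).real (S.BevO G FD h e a a' du j δ₂ ∩ Gs ∩
        localCylinder (↑(S.F G h) : Set (Sym2 V)) ↑(S.ξ G h) ∩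
        KNLevels.lattOnly G (S.Vx G h ∪ S.Γ.Ewv a e.1 e.2 ∪ S.Γ.Stub a' (tgt e) du j)) := by
  have hB : DeterminedBy (S.BevO G FD h e a a' du j δ₂ ∩ Gs ∩ localCylinder (↑(S.F G h) : Set (Sym2 V)) ↑(S.ξ G h) ∩
      KNLevels.lattOnly G (S.Vx G h ∪ S.Γ.Ewv a e.1 e.2 ∪ S.Γ.Stub a' (tgt e) du j)) (↑(S.Fp G h e a a' du j) : Set (Sym2 V)) := by
    refine (((determinedBy_BevO h e a a' du j δ₂).mono (Finset.coe_subset.2 (Fj_subset_Fp h e a a' du j))).inter hG).inter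
      ((determinedBy_localCylinder _ _).mono (ValidO.coe_F_subset_Fp hV j)) |>.inter ?_
    exact determinedBy_lattOnly _
  refine prodBernoulli_real_inter_le_of_pinW_le _ _ (measurableSet_Aface h e a a' du j) hB fun T _ hTB => ?_
  obtain ⟨⟨⟨hTB, -⟩, hTc⟩, hTl⟩ := hTB
  have hTB' : (prodBernoulli (S.Wt G h e a a' du j (obs ↑T (S.envO G h e a)))).real
      (⋃ b ∈ FD.Face a' (tgt e) du (j + 1), openConn S.Γ.root b) ≤ 1 - δ₂ := hTB
  rw [pinW_Wfull_eq_WtO hV ha' hdu hSt hj hTc hTl]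
  refine le_trans (measureReal_mono ?_ (measure_ne_top _ _)) hTB'
  rw [Aface, ← Finset.set_biUnion_coe]
  exact biUnion_openConnIn_subset_biUnion_openConn _ _ _

/-- **The chain, conditioned on an event `D` determined by the fresh edges of `E_i ∪ E_{w,v}`**: `μ(G_j ∩ [ξ] ∩ D) ≤ (1 - δ₂)^j μ(D)` for `j ≤ K`.
[cite: KozmaNitzan2024, §4 p. 31 ((36))] -/
theorem real_Gch_inter_leO {δ₂ : ℝ} (hδ₂ : δ₂ ≤ 1) {D : Set (BondConfig V)}
    (hD : DeterminedBy D (↑(S.baseF G h e a \ S.F G h) : Set (Sym2 V))) (hDm : MeasurableSet D) :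
    ∀ j ≤ S.Γ.K, (prodBernoulli (S.Wfull G h e a a' du)).real
        (S.GchO G FD h e a a' du δ₂ j ∩ localCylinder (↑(S.F G h) : Set (Sym2 V)) ↑(S.ξ G h) ∩ D) ≤
      (1 - δ₂) ^ j * (prodBernoulli (S.Wfull G h e a a' du)).real D
  | 0, _ => by
    rw [pow_zero, one_mul]
    exact measureReal_mono (fun ω hω => hω.2) (measure_ne_top _ _)
  | j + 1, hj => by
    set μ := prodBernoulli (S.Wfull G h e a a' du) with hμ
    set Cyl := localCylinder (↑(S.F G h) : Set (Sym2 V)) (↑(S.ξ G h) : Set (Sym2 V)) with hCyl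
    set L := KNLevels.lattOnly G (S.Vx G h ∪ S.Γ.Ewv a e.1 e.2 ∪ S.Γ.Stub a' (tgt e) du j) with hL
    have hj' : j < S.Γ.K := by omega
    have ih := real_Gch_inter_leO hδ₂ hD hDm j hj'.le
    have hDj : DeterminedBy D (↑(S.Fp G h e a a' du j) : Set (Sym2 V)) :=
      hD.mono ((Finset.coe_subset.2 Finset.sdiff_subset).trans (Finset.coe_subset.2 (baseF_subset_Fp h e a a' du j)))
    have e1 : μ.real (S.GchO G FD h e a a' du δ₂ (j + 1) ∩ Cyl ∩ D) =
        μ.real (S.Aface G FD h e a a' du j ∩ (S.BevO G FD h e a a' du j δ₂ ∩ (S.GchO G FD h e a a' du δ₂ j ∩ D) ∩ Cyl ∩ L)) := by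
      refine measureReal_congr ?_
      filter_upwards [ValidO.ae_lattOnly hV (a := a) (a' := a') (du := du)
        (S.Vx G h ∪ S.Γ.Ewv a e.1 e.2 ∪ S.Γ.Stub a' (tgt e) du j)] with ω hωL
      refine propext ⟨?_, ?_⟩
      · rintro ⟨⟨⟨hA, hB, hG⟩, hC⟩, hD'⟩; exact ⟨hA, ⟨⟨hB, hG, hD'⟩, hC⟩, hωL⟩
      · rintro ⟨hA, ⟨⟨hB, hG, hD'⟩, hC⟩, -⟩; exact ⟨⟨⟨hA, hB, hG⟩, hC⟩, hD'⟩
    rw [e1]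
    refine (real_Aface_inter_leO hV ha' hdu hSt hj' ((determinedBy_GchO h e a a' du δ₂ j).inter hDj)).trans ?_
    rw [pow_succ, mul_comm ((1 - δ₂) ^ j), mul_assoc]
    refine mul_le_mul_of_nonneg_left (le_trans (measureReal_mono ?_ (measure_ne_top _ _)) ih) (by linarith)
    rintro ω ⟨⟨⟨-, hG, hD'⟩, hC⟩, -⟩
    exact ⟨⟨hG, hC⟩, hD'⟩

/-! ## (37): a bad direction at the anchor `a'` -/

omit [Countable V] hV ha' hdu hSt in
/-- Reaching `M_x` through the corridor forces all the `A'_j` — from the two consequences of the FACE-PREFIX geometry (I3): `Reach ⊆ A'_{K-1}`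
and `A'_j ⊆ A'_{j-1}` on lattice-only configurations. [cite: KozmaNitzan2024, §4 p. 31 ("to hit M_x via H_{v,x} you must pass through all the F^j")] -/
theorem mem_Aface_of_reachO (hSt' : StepsGeom S.Γ FD)
    (hP1 : ∀ ω, ω ∈ KNLevels.lattOnly G (S.Vx G h ∪ S.Γ.Ewv a e.1 e.2 ∪ FD.Hfull a' (tgt e) du) →
      ω ∈ S.Reach G FD h e a a' du → ω ∈ S.Aface G FD h e a a' du (S.Γ.K - 1))
    (hP2 : ∀ ω j, 1 ≤ j → j < S.Γ.K → ω ∈ KNLevels.lattOnly G (S.Vx G h ∪ S.Γ.Ewv a e.1 e.2 ∪ S.Γ.Stub a' (tgt e) du (j + 1)) →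
      ω ∈ S.Aface G FD h e a a' du j → ω ∈ S.Aface G FD h e a a' du (j - 1))
    {ω : BondConfig V} (hωL : ω ∈ KNLevels.lattOnly G (S.Vx G h ∪ S.Γ.Ewv a e.1 e.2 ∪ FD.Hfull a' (tgt e) du))
    (hR : ω ∈ S.Reach G FD h e a a' du) {j : ℕ} (hj : j < S.Γ.K) : ((ω ∈ S.Aface G FD h e a a' du j) : Prop) := by
  have main : ∀ m, m < S.Γ.K → ω ∈ S.Aface G FD h e a a' du (S.Γ.K - 1 - m) := by
    intro m
    induction m with
    | zero => intro _; exact hP1 ω hωL hR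
    | succ m ih =>
      intro hm
      have h1 := ih (by omega)
      have h2 : S.Γ.K - 1 - (m + 1) = S.Γ.K - 1 - m - 1 := by omega
      rw [h2]
      refine hP2 ω _ (by omega) (by omega) ?_ h1
      exact lattOnly_anti (region_subset_regionH hSt' h e a a' du (by omega)) hωL
  have := main (S.Γ.K - 1 - j) (by omega)
  have h3 : S.Γ.K - 1 - (S.Γ.K - 1 - j) = j := by omega
  rwa [h3] at this

omit [Countable V] hV ha' hdu hSt in
/-- All `B_j` and all `A'_j` give `G_K`. [folklore] -/
theorem mem_Gch_of_forallO {δ₂ : ℝ} {ω : BondConfig V} (hB : ∀ j < S.Γ.K, ω ∈ S.BevO G FD h e a a' du j δ₂)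
    (hA : ∀ j < S.Γ.K, ω ∈ S.Aface G FD h e a a' du j) : ∀ j ≤ S.Γ.K, ω ∈ S.GchO G FD h e a a' du δ₂ j
  | 0, _ => Set.mem_univ _
  | j + 1, hj => ⟨hA j (by omega), hB j (by omega), mem_Gch_of_forallO hB hA j (by omega)⟩

omit [Countable V] hV ha' hdu hSt in
/-- **Step III inside Step IV**: given the target lemma at the face (I2: reaching `F^{j+1}` with probability `> 1 - δ₂` under the weighting of
(30) makes level `j` good), a bad direction lies in every `B_j`. [cite: KozmaNitzan2024, §4 p. 30 (Step III)] -/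
theorem badA_subset_BevO {δ₂ : ℝ}
    (hface : ∀ j < S.Γ.K, ∀ o : Finset (Sym2 V),
      1 - δ₂ < (prodBernoulli (S.Wt G h e a a' du j o)).real (⋃ b ∈ FD.Face a' (tgt e) du (j + 1), openConn S.Γ.root b) →
        S.cond G h e a a' du j o)
    {j : ℕ} (hj : j < S.Γ.K) : S.badAO G h e a a' du ⊆ S.BevO G FD h e a a' du j δ₂ := by
  intro ω hω
  by_contra hB
  simp only [BevO, Set.mem_setOf_eq, not_le] at hB
  exact hω j hj (hface j hj _ hB)

/-- **(36)–(37) at the anchor `a'`, conditioned on `D`**: `μ(badAO ∩ D) ≤ (1 - δ₂)^K μ(D) + μ(Reachᶜ ∩ D)`, given the face-prefix consequences (I3)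
and the target lemma at the faces (I2). [cite: KozmaNitzan2024, §4 p. 31 ((36), (37))] -/
theorem real_badA_inter_leO {δ₂ : ℝ} (hδ₂ : δ₂ ≤ 1) {D : Set (BondConfig V)}
    (hD : DeterminedBy D (↑(S.baseF G h e a \ S.F G h) : Set (Sym2 V))) (hDm : MeasurableSet D)
    (hP1 : ∀ ω, ω ∈ KNLevels.lattOnly G (S.Vx G h ∪ S.Γ.Ewv a e.1 e.2 ∪ FD.Hfull a' (tgt e) du) →
      ω ∈ S.Reach G FD h e a a' du → ω ∈ S.Aface G FD h e a a' du (S.Γ.K - 1))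
    (hP2 : ∀ ω j, 1 ≤ j → j < S.Γ.K → ω ∈ KNLevels.lattOnly G (S.Vx G h ∪ S.Γ.Ewv a e.1 e.2 ∪ S.Γ.Stub a' (tgt e) du (j + 1)) →
      ω ∈ S.Aface G FD h e a a' du j → ω ∈ S.Aface G FD h e a a' du (j - 1))
    (hface : ∀ j < S.Γ.K, ∀ o : Finset (Sym2 V),
      1 - δ₂ < (prodBernoulli (S.Wt G h e a a' du j o)).real (⋃ b ∈ FD.Face a' (tgt e) du (j + 1), openConn S.Γ.root b) →
        S.cond G h e a a' du j o) :
    (prodBernoulli (S.Wfull G h e a a' du)).real (S.badAO G h e a a' du ∩ D) ≤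
      (1 - δ₂) ^ S.Γ.K * (prodBernoulli (S.Wfull G h e a a' du)).real D +
        (prodBernoulli (S.Wfull G h e a a' du)).real ((S.Reach G FD h e a a' du)ᶜ ∩ D) := by
  set μ := prodBernoulli (S.Wfull G h e a a' du) with hμ
  set Cyl := localCylinder (↑(S.F G h) : Set (Sym2 V)) (↑(S.ξ G h) : Set (Sym2 V)) with hCyl
  set L := KNLevels.lattOnly G (S.Vx G h ∪ S.Γ.Ewv a e.1 e.2 ∪ FD.Hfull a' (tgt e) du) with hL
  have hae : ∀ᵐ ω ∂μ, ω ∈ Cyl ∩ L := by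
    filter_upwards [ValidO.ae_cyl hV ha' hSt (du := du),
      ValidO.ae_lattOnly hV (a := a) (a' := a') (du := du) (S.Vx G h ∪ S.Γ.Ewv a e.1 e.2 ∪ FD.Hfull a' (tgt e) du)] with ω h1 h2
    exact ⟨h1, h2⟩
  have hnull : μ.real (Cyl ∩ L)ᶜ = 0 := by
    have : μ (Cyl ∩ L)ᶜ = 0 := mem_ae_iff.1 hae
    exact (measureReal_eq_zero_iff (measure_ne_top _ _)).2 this
  have h1 : μ.real (S.badAO G h e a a' du ∩ D) ≤ μ.real (S.badAO G h e a a' du ∩ D ∩ (Cyl ∩ L)) + μ.real (Cyl ∩ L)ᶜ := by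
    refine le_trans (measureReal_mono ?_ (measure_ne_top _ _)) (measureReal_union_le _ _)
    intro ω hω
    by_cases h' : ω ∈ Cyl ∩ L
    · exact Or.inl ⟨hω, h'⟩
    · exact Or.inr h'
  have h2 : S.badAO G h e a a' du ∩ D ∩ (Cyl ∩ L) ⊆
      (S.GchO G FD h e a a' du δ₂ S.Γ.K ∩ Cyl ∩ D) ∪ ((S.Reach G FD h e a a' du)ᶜ ∩ D) := by
    rintro ω ⟨⟨hω, hD'⟩, hC, hωL⟩
    by_cases hR : ω ∈ S.Reach G FD h e a a' du
    · refine Or.inl ⟨⟨mem_Gch_of_forallO (fun j hj => badA_subset_BevO hface hj hω)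
        (fun j hj => mem_Aface_of_reachO hSt hP1 hP2 hωL hR hj) _ le_rfl, hC⟩, hD'⟩
    · exact Or.inr ⟨hR, hD'⟩
  calc μ.real (S.badAO G h e a a' du ∩ D) ≤ μ.real (S.badAO G h e a a' du ∩ D ∩ (Cyl ∩ L)) + μ.real (Cyl ∩ L)ᶜ := h1
    _ ≤ μ.real ((S.GchO G FD h e a a' du δ₂ S.Γ.K ∩ Cyl ∩ D) ∪ ((S.Reach G FD h e a a' du)ᶜ ∩ D)) + 0 := by
        rw [hnull]; exact add_le_add (measureReal_mono h2 (measure_ne_top _ _)) le_rfl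
    _ ≤ μ.real (S.GchO G FD h e a a' du δ₂ S.Γ.K ∩ Cyl ∩ D) + μ.real ((S.Reach G FD h e a a' du)ᶜ ∩ D) := by
        rw [add_zero]; exact measureReal_union_le _ _
    _ ≤ (1 - δ₂) ^ S.Γ.K * μ.real D + μ.real ((S.Reach G FD h e a a' du)ᶜ ∩ D) :=
        add_le_add (real_Gch_inter_leO hV ha' hdu hSt hδ₂ hD hDm _ le_rfl) le_rfl

end KSchA

end KNCells

end Transplant

end Summit.CriticalPhenomena.PercolationContinuityZ3.Theorems

end
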